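import Literature.Analysis.FluidPDE.HardSphereCollisionRecord
import Literature.MathematicalPhysics.KineticTheory.HardSphereEuler
import HarnessLib

/-!
# Swap symmetry of collision sums along the hard-sphere flow on `𝕋³`
# (helper `ccb1_collisionSum_swap` of the line `birth`, crux `TwoClocks.EquilibriumFastWindowLD`,
# stmt-AtomisticToContinuum-14440)

Collision records along a hard-sphere trajectory are ORDERED: a binary collision of the pair
`{p, q}` at time `t` contributes the two records `(fst, snd) = (p, q)` and `(q, p)` to every
`HardSphereFlow.collisionSum` (`Literature.Analysis.FluidPDE.HardSphereCollisionRecord`). This file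
proves the resulting involutive symmetry of collision sums on the flat torus at reduced diameter
`0 < σ < 1/2`: for EVERY functional `F` of the record, every time set `S` and every initial datum
`z` (good or not — the identity is configuration-wise),

`Φ.collisionSum S F z = Φ.collisionSum S (F ∘ swap) z`,

where `swap` exchanges `fst ↔ snd`, `fstPos ↔ sndPos`, the two components of the pre- and of the
post-collisional velocity pairs, and reverses the impact vector. The record-level fact is
`ofConfig_swap`: at an ordered contact pair `(i, j)` of a configuration in a regular geometry,
`ofConfig G ε z t j i` IS the swap of `ofConfig G ε z t i j` (`sepVec_comm` at contact,
`reflectVel_neg`, `reflectVel_swap`); the sum over the ordered contact pairs is then reindexed by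
`Prod.swap` (`swap_mem_contactPairs_iff`).

Typical uses (pair-clamped streams of the line `birth`): the number of records in a window with
`snd = j` equals the number with `fst = j` (take `F c = if c.snd = j then 1 else 0`), and more
generally any bookkeeping over `snd` is a bookkeeping over `fst` of the swapped functional.

References: Gallagher–Saint-Raymond–Texier 2013 §4.1 (collisions of the hard-sphere flow);
Aoki–Pulvirenti–Simonella–Tsuji 2015 §5 (the collision record of a trajectory).
-/

noncomputable section

open MeasureTheory Set
open scoped ENNReal BigOperators

namespace Summit.AtomisticToContinuum.HydrodynamicLimit.Theorems.ClampedCorrectorBirth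

open Literature.Analysis.FluidPDE Literature.MathematicalPhysics.KineticTheory

section Record

variable {d : Type*} [Fintype d] {X : Type*} [TopologicalSpace X] {n : ℕ}
  {G : Geometry d X} {ε : ℝ}

/-- **The record of the reversed ordered pair is the swapped record.** At an ordered contact pair
`(i, j)` of a configuration `z` in a regular geometry, the record of `(j, i)` read off `z` at time
`t` is obtained from the record of `(i, j)` by exchanging the two particles: `fst ↔ snd`,
`fstPos ↔ sndPos`, the components of `preVel` and of `postVel`, and `impactVec ↦ -impactVec`
(`G.sepVec x_j x_i = -G.sepVec x_i x_j` at contact; the reflection law is even in the impact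
direction and symmetric under exchange of the particles). -/
theorem ofConfig_swap (hG : G.IsHardSphereRegular ε) {z : Config n d X} {i j : Fin n} (t : ℝ)
    (hp : (i, j) ∈ contactPairs G ε z) :
    HardSphereCollisionRecord.ofConfig G ε z t j i =
      { time := (HardSphereCollisionRecord.ofConfig G ε z t i j).time
        fst := (HardSphereCollisionRecord.ofConfig G ε z t i j).snd
        snd := (HardSphereCollisionRecord.ofConfig G ε z t i j).fst
        fstPos := (HardSphereCollisionRecord.ofConfig G ε z t i j).sndPos
        sndPos := (HardSphereCollisionRecord.ofConfig G ε z t i j).fstPos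
        impactVec := -(HardSphereCollisionRecord.ofConfig G ε z t i j).impactVec
        preVel := ((HardSphereCollisionRecord.ofConfig G ε z t i j).preVel.2,
          (HardSphereCollisionRecord.ofConfig G ε z t i j).preVel.1)
        postVel := ((HardSphereCollisionRecord.ofConfig G ε z t i j).postVel.2,
          (HardSphereCollisionRecord.ofConfig G ε z t i j).postVel.1) } := by
  obtain ⟨-, hc⟩ := mem_contactPairs.1 hp
  have hε : ‖G.sepVec (z i).1 (z j).1‖ ≤ ε := (mem_contactSet.1 hc).2.le
  have hsep : G.sepVec (z j).1 (z i).1 = -G.sepVec (z i).1 (z j).1 := hG.sepVec_comm _ _ hε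
  have hpre : reflectVel (-G.sepVec (z i).1 (z j).1) ((z j).2, (z i).2) =
      ((reflectVel (G.sepVec (z i).1 (z j).1) ((z i).2, (z j).2)).2,
        (reflectVel (G.sepVec (z i).1 (z j).1) ((z i).2, (z j).2)).1) := by
    rw [reflectVel_neg]
    exact reflectVel_swap _ ((z i).2, (z j).2)
  simp only [HardSphereCollisionRecord.ofConfig, hsep, hpre, smul_neg]

/-- **Swap symmetry of a sum over the ordered contact pairs** of a configuration in a regular
geometry: reindexing by `Prod.swap` (`swap_mem_contactPairs_iff`) and `ofConfig_swap`. -/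
theorem sum_contactPairs_ofConfig_swap {M : Type*} [AddCommMonoid M] (hG : G.IsHardSphereRegular ε)
    (z : Config n d X) (t : ℝ) (F : HardSphereCollisionRecord d X n → M) :
    ∑ p ∈ contactPairs G ε z, F (HardSphereCollisionRecord.ofConfig G ε z t p.1 p.2) =
      ∑ p ∈ contactPairs G ε z,
        F { time := (HardSphereCollisionRecord.ofConfig G ε z t p.1 p.2).time
            fst := (HardSphereCollisionRecord.ofConfig G ε z t p.1 p.2).snd
            snd := (HardSphereCollisionRecord.ofConfig G ε z t p.1 p.2).fst
            fstPos := (HardSphereCollisionRecord.ofConfig G ε z t p.1 p.2).sndPos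
            sndPos := (HardSphereCollisionRecord.ofConfig G ε z t p.1 p.2).fstPos
            impactVec := -(HardSphereCollisionRecord.ofConfig G ε z t p.1 p.2).impactVec
            preVel := ((HardSphereCollisionRecord.ofConfig G ε z t p.1 p.2).preVel.2,
              (HardSphereCollisionRecord.ofConfig G ε z t p.1 p.2).preVel.1)
            postVel := ((HardSphereCollisionRecord.ofConfig G ε z t p.1 p.2).postVel.2,
              (HardSphereCollisionRecord.ofConfig G ε z t p.1 p.2).postVel.1) } := by
  symm
  refine Finset.sum_equiv (Equiv.prodComm (Fin n) (Fin n)) (fun p => ?_) (fun p hp => ?_)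
  · exact (swap_mem_contactPairs_iff hG (p := p)).symm
  · obtain ⟨i, j⟩ := p
    change _ = F (HardSphereCollisionRecord.ofConfig G ε z t j i)
    rw [ofConfig_swap hG t hp]

end Record

/-- **Swap symmetry of collision sums along the hard-sphere flow on `𝕋³`.** For reduced diameter
`0 < σ < 1/2` (so that the torus geometry is hard-sphere regular at `hsDiameter σ N ≤ σ < 1/2`),
every flow `Φ` of `N + 1` spheres, every set of times `S`, every functional `F` of the collision
record and every initial datum `z`: the collision sum of `F` equals the collision sum of `F`
precomposed with the exchange of the two partners (`fst ↔ snd`, `fstPos ↔ sndPos`, components of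
`preVel` and `postVel` exchanged, `impactVec` reversed). No good-set hypothesis and no finiteness is
needed: both sides are the same `finsum` over the collision times, the inner sums over the ordered
contact pairs agreeing time by time (`sum_contactPairs_ofConfig_swap`). Typical instance: with
`F c = if c.snd = j then f c.time else 0` the right-hand side is the sum of `f c.time` over the records
with `fst = j` — counting records by `snd` is counting records by `fst`. -/
theorem ccb1_collisionSum_swap : ∀ (σ : ℝ), 0 < σ → σ < 2⁻¹ → ∀ (N : ℕ)
    (Φ : HardSphereFlow (Torus.geometry (Fin 3)) (hsDiameter σ N) (N + 1)) (S : Set ℝ)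
    (F : HardSphereCollisionRecord (Fin 3) T3 (N + 1) → ℝ) (z : Config (N + 1) (Fin 3) T3),
    Φ.collisionSum S F z = Φ.collisionSum S (fun c => F
      { time := c.time, fst := c.snd, snd := c.fst, fstPos := c.sndPos, sndPos := c.fstPos,
        impactVec := -c.impactVec, preVel := (c.preVel.2, c.preVel.1),
        postVel := (c.postVel.2, c.postVel.1) }) z := by
  intro σ hσ hσ2 N Φ S F z
  have hG : (Torus.geometry (Fin 3)).IsHardSphereRegular (hsDiameter σ N) :=
    Torus.isHardSphereRegular_geometry ((hsDiameter_le hσ.le N).trans_lt hσ2)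
  simp only [HardSphereFlow.collisionSum_eq, collisionSum_eq_collisionPairSum, collisionPairSum]
  exact finsum_mem_congr rfl fun t _ => sum_contactPairs_ofConfig_swap hG (Φ.flow t z) t F

end Summit.AtomisticToContinuum.HydrodynamicLimit.Theorems.ClampedCorrectorBirth
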